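import Literature.Geometry.Riemannian.SphericalCylinderInclusionDomination
import HarnessLib

/-!
# Density-level small-scale Gaussian domination for centres ON `N = S⁴ × ℝ ⊂ ℝ⁶`

Registered helper `helper_gaussianAreaLeCylDensity` (H1 of the lead's "unit lower density along
cylinder flows" chain; line `killing-flux`, crux `CylinderEntropy.CylinderRungTwo`,
stmt-SmoothPoincare4-7631).

For every `0 < δ ≤ 1` there are `κ ∈ [0, δ]` and `t₁ > 0` such that for every measurable
`A ⊆ N = {z ∈ ℝ⁶ | ∑_{i<5} zᵢ² = 1}`, every centre `y ∈ N` and every scale `0 < t ≤ t₁`,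
`F_{y,t}(A) = gaussianArea 4 y t A ≤ (1 + δ) · F̂_{y,(1+κ)t}(A) + δ · μH⁴(A)/μH⁴(S⁴)`:
the Colding–Minicozzi Gaussian area of `A` centred on the cylinder is dominated by the typed
slice-normalised density `cylDensity A y ((1+κ)t)` at the SAME centre and the broadened scale, plus a
small multiple of the area ratio.  This is the density-level form of the landed entropy-level theorem
`Literature.Geometry.Riemannian.SphericalCylinderInclusion.gaussianArea_le_mul_cylEntropy_of_small_scale`
(which bounds both atoms further by `λ_cyl(A)`), with the same one-kernel certificate:
* `norm_sub_sq_of_mem_cylinder` — `‖z - y‖² = 2(1 - ⟨z', y'⟩) + (z₅ - y₅)²` for `z, y ∈ N`;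
* `pointwise_domination_of_mem` — for `y ∈ N` the matched centre is `y` itself (`‖y'‖ = 1`): near
  points see the broadened kernel `(1+κ)² vol(S⁴)⁻¹ K_{y,(1+κ)t}` (Cheeger–Yau, PROVED in the tree:
  `CheegerYauZonalSphereFour_holds`, through `SphericalCylinderInclusion.near_kernel_bound` at `ρ = 1`),
  far points only the area atom `c₀ vol(S⁴)⁻¹` (tree `far_bound`);
* `gaussianArea_le_cylDensity_add_of_pointwise` — the certificate integrates to
  `F_{y,t}(A) ≤ c₁ F̂_{p,σ}(A) + c₀ μH⁴(A)/μH⁴(S⁴)` (the Haar factor of `μHE⁴ = c · μH⁴` on `ℝ⁵` and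
  `ℝ⁶` cancelling; Steps 2–4 of the tree's `gaussianArea_le_of_pointwise` verbatim, Step 5 kept at
  the density level);
* constants `ε = δ/40`, `κ = 3ε ≤ δ`, `c₀ = δ/4 ≤ δ`, `c₁ = (1+κ)² ≤ 1 + δ` (tree `constants`),
  `C = log(e⁴/6c₀) ≥ 0`, `t₁ = (ε²/(16e²(C+4)))²` (tree `smallness`).

## References
* J. Cheeger, S.-T. Yau, Comm. Pure Appl. Math. 34 (1981) 465–480 [CheegerYau1981]; E. B. Davies,
  *Heat kernels and spectral theory* (1989), Thm 5.6.1 [Davies1989].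
* T. H. Colding, W. P. Minicozzi II, Ann. of Math. 175 (2012) 755–833, §1. [ColdingMinicozzi2012]
-/

noncomputable section

open MeasureTheory Set Filter
open scoped ENNReal NNReal Topology BigOperators

set_option linter.dupNamespace false

namespace Summit.SmoothPoincare4.SmoothPoincare4.Cruxes.CylinderRungTwo.KillingFlux

open Literature.Geometry.Riemannian
open Literature.Geometry.Riemannian.SphericalCylinderEntropy (cylEntropy cylDensity cylKernel truncL
  cylKernel_eq zonal abs_sum_mul_le_one)
open Literature.Geometry.Riemannian.SphericalCylinderConformal (far_bound smallness constants
  gaussianNormalization_four euclideanHausdorffMeasure_sphere_four cylKernel_nonneg_of_mem)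
open Literature.Geometry.Riemannian.SphericalCylinderInclusion (near_kernel_bound)

/-- `‖z - y‖² = (1-1)² + 2·1·(1 - ⟨z', y'⟩) + (z₅ - y₅)²` for `z, y ∈ N` (`‖z'‖ = ‖y'‖ = 1`), written in
the shape of `SphericalCylinderInclusion.near_kernel_bound` with radial parameter `ρ = 1`. [folklore] -/
theorem norm_sub_sq_of_mem_cylinder {z y : EuclideanSpace ℝ (Fin 6)}
    (hz : ∑ i : Fin 5, z (Fin.castSucc i) ^ 2 = 1) (hy : ∑ i : Fin 5, y (Fin.castSucc i) ^ 2 = 1) :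
    ‖z - y‖ ^ 2 = (1 - 1) ^ 2 + 2 * 1 * (1 - ∑ i : Fin 5, z (Fin.castSucc i) * y (Fin.castSucc i)) +
      (z 5 - y 5) ^ 2 := by
  rw [EuclideanSpace.real_norm_sq_eq, Fin.sum_univ_castSucc (f := fun j : Fin 6 => ((z - y) j) ^ 2)]
  have h5 : (Fin.last 5 : Fin 6) = 5 := rfl
  simp only [PiLp.sub_apply, h5]
  have h : ∀ i : Fin 5, (z (Fin.castSucc i) - y (Fin.castSucc i)) ^ 2 =
      z (Fin.castSucc i) ^ 2 - 2 * (z (Fin.castSucc i) * y (Fin.castSucc i)) +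
        y (Fin.castSucc i) ^ 2 := fun i => by ring
  simp only [h, Finset.sum_add_distrib, Finset.sum_sub_distrib, ← Finset.mul_sum, hz, hy]
  ring

/-- **Pointwise domination for centres on `N`.**  Under the smallness
`16e² t (log(e⁴/6c₀) - 2 log t) ≤ ε²` (`0 < ε ≤ 1/5`, `κ ≥ 0`, `(1+κ)(1-ε)² ≥ 1`, `c₀ > 0`), for a
centre `y ∈ N` and every `z ∈ N` the Euclidean kernel `(4πt)⁻² e^{-‖z - y‖²/4t}` is at most
`(1+κ)² vol(S⁴)⁻¹ K_{y,(1+κ)t}(z) + c₀ vol(S⁴)⁻¹`: far points (`‖z - y‖² ≥ 4tΛ`,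
`Λ = log(e⁴/6c₀) - 2 log t`) see only the area atom (tree `far_bound` at height `0`), near points the
kernel broadened to scale `(1+κ)t` at the SAME centre `y` (for `y ∈ N` the matched centre
`(y'/‖y'‖, y₅)` of `SphericalCylinderInclusion.pointwise_domination` is `y`, `‖y'‖ = 1`; Cheeger–Yau is
PROVED in the tree, `CheegerYauZonalSphereFour_holds`). [folklore] -/
theorem pointwise_domination_of_mem {ε κ c₀ : ℝ} (hε : 0 < ε) (hε5 : ε ≤ 1 / 5) (hκ : 0 ≤ κ)
    (hκε : 1 ≤ (1 + κ) * (1 - ε) ^ 2) (hc₀ : 0 < c₀) {t : ℝ} (ht : 0 < t)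
    (hsmall : 16 * Real.exp 2 * t * (Real.log (Real.exp 4 / (6 * c₀)) - 2 * Real.log t) ≤ ε ^ 2)
    {y : EuclideanSpace ℝ (Fin 6)} (hy : ∑ i : Fin 5, y (Fin.castSucc i) ^ 2 = 1)
    {z : EuclideanSpace ℝ (Fin 6)} (hz : ∑ i : Fin 5, z (Fin.castSucc i) ^ 2 = 1) :
    ((4 * Real.pi * t) ^ 2)⁻¹ * Real.exp (-‖z - y‖ ^ 2 / (4 * t)) ≤
      (1 + κ) ^ 2 * (3 / (8 * Real.pi ^ 2)) * cylKernel y ((1 + κ) * t) z +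
        c₀ * (3 / (8 * Real.pi ^ 2)) := by
  have hπ := Real.pi_pos
  have hκ1 : 0 < 1 + κ := by linarith
  have hK0 : 0 ≤ cylKernel y ((1 + κ) * t) z := cylKernel_nonneg_of_mem hy hz (by positivity)
  -- the far threshold `4tΛ ≤ ε²` (`16e² t Λ ≤ ε²` and `16e² ≥ 4`)
  set Λ := Real.log (Real.exp 4 / (6 * c₀)) - 2 * Real.log t with hΛ
  have hthr : 4 * t * Λ ≤ ε ^ 2 := by
    have he : (1 : ℝ) ≤ Real.exp 2 := Real.one_le_exp (by norm_num)
    rcases le_or_gt 0 (t * Λ) with hX | hX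
    · nlinarith [mul_le_mul_of_nonneg_right he hX]
    · nlinarith [sq_nonneg ε]
  have h0 : t * Real.exp (-2 * 0) = t := by rw [mul_zero, Real.exp_zero, mul_one]
  by_cases hfar : 4 * t * Λ ≤ ‖z - y‖ ^ 2
  · -- far: only the area atom (tree `far_bound` at height `s = 0`, `t₀ = 0`)
    have h := far_bound (s := 0) (t₀ := 0) (c₀ := c₀) (D := ‖z - y‖ ^ 2) ht hc₀ (by norm_num)
      (by rwa [h0])
    have h' : ((4 * Real.pi * t) ^ 2)⁻¹ * Real.exp (-‖z - y‖ ^ 2 / (4 * t)) ≤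
        c₀ * (3 / (8 * Real.pi ^ 2)) := by
      simpa using h
    exact h'.trans (le_add_of_nonneg_left (by positivity))
  · -- near: `‖z - y‖² = 2(1 - c) + (z₅ - y₅)²`, `c = ⟨z', y'⟩`, and Cheeger–Yau at scale `(1+κ)t`
    push Not at hfar
    set c := ∑ i : Fin 5, z (Fin.castSucc i) * y (Fin.castSucc i) with hc_def
    have hcabs : |c| ≤ 1 := abs_sum_mul_le_one hz hy
    obtain ⟨hc1, hc2⟩ := abs_le.1 hcabs
    have hsplit := norm_sub_sq_of_mem_cylinder hz hy
    rw [← hc_def] at hsplit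
    have hnear : (1 - (1 : ℝ)) ^ 2 + 2 * 1 * (1 - c) ≤ ε ^ 2 := by
      nlinarith [sq_nonneg (z 5 - y 5)]
    have hZ := CheegerYauZonalSphereFour_holds ((1 + κ) * t) (by positivity) c hc1 hc2
    have h := near_kernel_bound (v := z 5 - y 5) hε hε5 hκ hκε ht hc1 hc2 zero_le_one hnear hZ
    have hK : cylKernel y ((1 + κ) * t) z =
        zonal ((1 + κ) * t) c * Real.exp (-((z 5 - y 5) ^ 2) / (4 * ((1 + κ) * t))) :=
      cylKernel_eq _ _ _
    rw [hsplit, hK]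
    exact h.trans (le_add_of_nonneg_right (by positivity))

/-- **A one-kernel certificate integrates, at the density level.**  If on `N` the Euclidean kernel
is dominated pointwise, `(4πt)⁻² e^{-‖z-y‖²/4t} ≤ c₁ (3/8π²) K_{p,σ}(z) + c₀ (3/8π²)` (`p ∈ N`, `σ > 0`,
`c₁, c₀ ≥ 0`, `3/8π² = 1/vol S⁴`), then for every measurable `A ⊆ N`,
`F_{y,t}(A) = gaussianArea 4 y t A ≤ c₁ F̂_{p,σ}(A) + c₀ μH⁴(A)/μH⁴(S⁴)`, where
`F̂_{p,σ}(A) = cylDensity A p σ = vol(S⁴)⁻¹ ∫_A K_{p,σ} dμH⁴`: Steps 2–4 of the tree's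
`SphericalCylinderInclusion.gaussianArea_le_of_pointwise` (the Haar factor of `μHE⁴ = c μH⁴` on `ℝ⁵`
and on `ℝ⁶` cancelling), its Step 5 stopped before bounding the two atoms by `λ_cyl(A)`. [folklore] -/
theorem gaussianArea_le_cylDensity_add_of_pointwise {c₁ c₀ : ℝ} (hc₁ : 0 ≤ c₁) (hc₀ : 0 ≤ c₀)
    {p : EuclideanSpace ℝ (Fin 6)} (hp : ∑ i : Fin 5, p (Fin.castSucc i) ^ 2 = 1) {σ : ℝ}
    (hσ : 0 < σ) {y : EuclideanSpace ℝ (Fin 6)} {t : ℝ} (ht : 0 < t)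
    (hpt : ∀ z : EuclideanSpace ℝ (Fin 6), (∑ i : Fin 5, z (Fin.castSucc i) ^ 2 = 1) →
      ((4 * Real.pi * t) ^ 2)⁻¹ * Real.exp (-‖z - y‖ ^ 2 / (4 * t)) ≤
        c₁ * (3 / (8 * Real.pi ^ 2)) * cylKernel p σ z + c₀ * (3 / (8 * Real.pi ^ 2)))
    (A : Set (EuclideanSpace ℝ (Fin 6)))
    (hAN : ∀ z ∈ A, ∑ i : Fin 5, z (Fin.castSucc i) ^ 2 = 1) (hAm : MeasurableSet A) :
    gaussianArea 4 y t A ≤ ENNReal.ofReal c₁ * cylDensity A p σ +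
      ENNReal.ofReal c₀ * ((μH[4] (Metric.sphere (0 : EuclideanSpace ℝ (Fin 5)) 1))⁻¹ * μH[4] A) := by
  have hπ := Real.pi_pos
  set V' : ℝ := 3 / (8 * Real.pi ^ 2) with hV'
  have hV'0 : 0 < V' := by positivity
  -- Step 2: the pointwise bound in `ℝ≥0∞`
  have hpt' : ∀ z ∈ A, gaussianNormalization 4 t * gaussianWeight y t z ≤
      ENNReal.ofReal (V' * c₀) + ENNReal.ofReal (V' * c₁) * ENNReal.ofReal (cylKernel p σ z) := by
    intro z hz
    have hzN := hAN z hz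
    have hK0 : 0 ≤ cylKernel p σ z := cylKernel_nonneg_of_mem hp hzN hσ
    have hle := hpt z hzN
    rw [gaussianNormalization_four ht, gaussianWeight, ← ENNReal.ofReal_mul (by positivity),
      ← ENNReal.ofReal_mul (by positivity), ← ENNReal.ofReal_add (by positivity) (by positivity)]
    refine ENNReal.ofReal_le_ofReal ?_
    calc ((4 * Real.pi * t) ^ 2)⁻¹ * Real.exp (-(‖z - y‖ ^ 2) / (4 * t))
        ≤ c₁ * V' * cylKernel p σ z + c₀ * V' := hle
      _ = V' * c₀ + V' * c₁ * cylKernel p σ z := by ring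
  -- Step 3: integrate
  have step2 : ∫⁻ z in A, gaussianNormalization 4 t * gaussianWeight y t z ∂μHE[4] ≤
      ENNReal.ofReal (V' * c₀) * μHE[4] A +
        ENNReal.ofReal (V' * c₁) * ∫⁻ z in A, ENNReal.ofReal (cylKernel p σ z) ∂μHE[4] := by
    calc ∫⁻ z in A, gaussianNormalization 4 t * gaussianWeight y t z ∂μHE[4]
        ≤ ∫⁻ z in A, (ENNReal.ofReal (V' * c₀) +
            ENNReal.ofReal (V' * c₁) * ENNReal.ofReal (cylKernel p σ z)) ∂μHE[4] :=
          setLIntegral_mono' hAm hpt'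
      _ = _ := by
          rw [lintegral_add_left measurable_const, setLIntegral_const,
            lintegral_const_mul' _ _ ENNReal.ofReal_ne_top]
  -- Step 4: from `μHE⁴` to the typed `μH⁴` ratios (the Haar factor `cH` cancels)
  set cH : ℝ≥0∞ := ((Measure.addHaarScalarFactor (volume : Measure (EuclideanSpace ℝ (Fin 4)))
      (μH[((4 : ℕ) : ℝ)] : Measure (EuclideanSpace ℝ (Fin 4))) : ℝ≥0) : ℝ≥0∞) with hcH_def
  have hcH0 : cH ≠ 0 :=
    ENNReal.coe_ne_zero.2 (Measure.addHaarScalarFactor_volume_hausdorffMeasure_ne_zero 4)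
  have hcHtop : cH ≠ ⊤ := ENNReal.coe_ne_top
  set S : ℝ≥0∞ := μH[4] (Metric.sphere (0 : EuclideanSpace ℝ (Fin 5)) 1) with hS_def
  have hμA : (μHE[4] : Measure (EuclideanSpace ℝ (Fin 6))) A = cH * μH[4] A := by
    rw [Measure.euclideanHausdorffMeasure_def, Measure.smul_apply, ENNReal.smul_def, smul_eq_mul]
    rfl
  have hIK := setLIntegral_euclideanHausdorffMeasure_eq_mul 4
    (fun z => ENNReal.ofReal (cylKernel p σ z)) A
  have hS : (μHE[4] : Measure (EuclideanSpace ℝ (Fin 5))) (Metric.sphere (0 : EuclideanSpace ℝ (Fin 5)) 1) =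
      cH * S := by
    rw [Measure.euclideanHausdorffMeasure_def, Measure.smul_apply, ENNReal.smul_def, smul_eq_mul]
    rfl
  have hV : ENNReal.ofReal V' = cH⁻¹ * S⁻¹ := by
    rw [hV', show (3 / (8 * Real.pi ^ 2) : ℝ) = (8 * Real.pi ^ 2 / 3)⁻¹ by field_simp,
      ENNReal.ofReal_inv_of_pos (by positivity), ← euclideanHausdorffMeasure_sphere_four, hS,
      ENNReal.mul_inv (Or.inl hcH0) (Or.inl hcHtop)]
  have hcancel : ∀ X : ℝ≥0∞, cH⁻¹ * S⁻¹ * (cH * X) = S⁻¹ * X := fun X => by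
    rw [mul_mul_mul_comm, ENNReal.inv_mul_cancel hcH0 hcHtop, one_mul]
  -- Step 5: the two atoms ARE the area ratio and the typed density
  have hatom0 : ENNReal.ofReal V' * (μHE[4] : Measure (EuclideanSpace ℝ (Fin 6))) A = S⁻¹ * μH[4] A := by
    rw [hV, hμA, hcancel]
  have hatom1 : ENNReal.ofReal V' * ∫⁻ z in A, ENNReal.ofReal (cylKernel p σ z) ∂μHE[4] =
      cylDensity A p σ := by
    rw [hV, hIK, hcancel]
    rfl
  calc gaussianArea 4 y t A
      = ∫⁻ z in A, gaussianNormalization 4 t * gaussianWeight y t z ∂μHE[4] := by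
        rw [gaussianArea_eq, lintegral_const_mul' _ _ (gaussianNormalization_ne_top 4 t)]
    _ ≤ ENNReal.ofReal (V' * c₀) * μHE[4] A +
          ENNReal.ofReal (V' * c₁) * ∫⁻ z in A, ENNReal.ofReal (cylKernel p σ z) ∂μHE[4] := step2
    _ = ENNReal.ofReal c₀ * (ENNReal.ofReal V' * (μHE[4] : Measure (EuclideanSpace ℝ (Fin 6))) A) +
          ENNReal.ofReal c₁ *
            (ENNReal.ofReal V' * ∫⁻ z in A, ENNReal.ofReal (cylKernel p σ z) ∂μHE[4]) := by
        rw [mul_comm V' c₀, mul_comm V' c₁, ENNReal.ofReal_mul hc₀, ENNReal.ofReal_mul hc₁, mul_assoc,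
          mul_assoc]
    _ = ENNReal.ofReal c₀ * (S⁻¹ * μH[4] A) + ENNReal.ofReal c₁ * cylDensity A p σ := by
        rw [hatom0, hatom1]
    _ = ENNReal.ofReal c₁ * cylDensity A p σ + ENNReal.ofReal c₀ * (S⁻¹ * μH[4] A) := add_comm _ _

/-- **Density-level small-scale Gaussian domination for centres on `N = S⁴ × ℝ ⊂ ℝ⁶`** (registered
helper H1 of line `killing-flux`).  For every `0 < δ ≤ 1` there are `κ ∈ [0, δ]` and `t₁ > 0` such that
for every measurable `A ⊆ N = {z ∈ ℝ⁶ | ∑_{i<5} zᵢ² = 1}`, every centre `y ∈ N` and every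
`0 < t ≤ t₁`, `gaussianArea 4 y t A ≤ (1+δ) · cylDensity A y ((1+κ)t) + δ · μH⁴(A)/μH⁴(S⁴)`.
Constants as in the tree's `gaussianArea_le_mul_cylEntropy_of_small_scale`: `ε = δ/40`, `κ = 3ε`,
`c₀ = δ/4 ≤ δ`, `(1+κ)² ≤ 1 + δ`, `t₁ = (ε²/(16e²(C+4)))²`, `C = log(e⁴/6c₀)` (tree `constants`,
`smallness`), then `pointwise_domination_of_mem` and `gaussianArea_le_cylDensity_add_of_pointwise`.
[folklore] -/
theorem helper_gaussianAreaLeCylDensity : ∀ δ : ℝ, 0 < δ → δ ≤ 1 → ∃ κ : ℝ, 0 ≤ κ ∧ κ ≤ δ ∧ ∃ t₁ : ℝ, 0 < t₁ ∧ ∀ A : Set (EuclideanSpace ℝ (Fin 6)), (∀ z ∈ A, ∑ i : Fin 5, z (Fin.castSucc i) ^ 2 = 1) → MeasurableSet A → ∀ y : EuclideanSpace ℝ (Fin 6), ∑ i : Fin 5, y (Fin.castSucc i) ^ 2 = 1 → ∀ t : ℝ, 0 < t → t ≤ t₁ → gaussianArea 4 y t A ≤ ENNReal.ofReal (1 + δ)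 * cylDensity A y ((1 + κ) * t) + ENNReal.ofReal δ * ((μH[4] (Metric.sphere (0 : EuclideanSpace ℝ (Fin 5)) 1))⁻¹ * μH[4] A) := by
  intro δ hδ hδ1
  obtain ⟨hε5, hκε, -⟩ := constants hδ hδ1
  set ε := δ / 40 with hε_def
  set κ := 3 * ε with hκ_def
  set c₀ := δ / 4 with hc₀_def
  have hε : 0 < ε := by positivity
  have hε1 : ε ≤ 1 := by linarith
  have hκ : 0 ≤ κ := by positivity
  have hκδ : κ ≤ δ := by linarith
  have hκ1 : 0 < 1 + κ := by linarith
  have hc₀ : 0 < c₀ := by positivity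
  have hπ := Real.pi_pos
  set C := Real.log (Real.exp 4 / (6 * c₀)) with hC_def
  have hC : 0 ≤ C := by
    refine Real.log_nonneg ?_
    rw [le_div_iff₀ (by positivity)]
    have : (4 : ℝ) + 1 ≤ Real.exp 4 := Real.add_one_le_exp 4
    linarith
  set t₁ := (ε ^ 2 / (16 * Real.exp 2 * (C + 4))) ^ 2 with ht₁
  have ht₁0 : 0 < t₁ := by positivity
  refine ⟨κ, hκ, hκδ, t₁, ht₁0, ?_⟩
  intro A hAN hAm y hy t ht htle
  -- smallness of the near region at `T = t ≤ t₁`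
  have hsmall : 16 * Real.exp 2 * t * (Real.log (Real.exp 4 / (6 * c₀)) - 2 * Real.log t) ≤ ε ^ 2 := by
    have h := smallness ht hε hε1 hC htle
    have h2 : C + 2 * Real.log (1 / t) = Real.log (Real.exp 4 / (6 * c₀)) - 2 * Real.log t := by
      rw [one_div, Real.log_inv, hC_def]; ring
    rwa [h2] at h
  -- the one-kernel certificate at the centre `y ∈ N` itself, broadened scale `σ = (1+κ)t`
  have hpt : ∀ z : EuclideanSpace ℝ (Fin 6), (∑ i : Fin 5, z (Fin.castSucc i) ^ 2 = 1) →
      ((4 * Real.pi * t) ^ 2)⁻¹ * Real.exp (-‖z - y‖ ^ 2 / (4 * t)) ≤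
        (1 + κ) ^ 2 * (3 / (8 * Real.pi ^ 2)) * cylKernel y ((1 + κ) * t) z +
          c₀ * (3 / (8 * Real.pi ^ 2)) :=
    fun z hz => pointwise_domination_of_mem hε hε5 hκ hκε hc₀ ht hsmall hy hz
  have hmain := gaussianArea_le_cylDensity_add_of_pointwise (c₁ := (1 + κ) ^ 2) (σ := (1 + κ) * t)
    (by positivity) hc₀.le hy (by positivity) ht hpt A hAN hAm
  -- the constants: `(1+κ)² ≤ 1 + δ` and `c₀ ≤ δ` for `δ ≤ 1`
  have hc₁δ : (1 + κ) ^ 2 ≤ 1 + δ := by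
    rw [hκ_def, hε_def]
    nlinarith [mul_nonneg hδ.le (sub_nonneg.2 hδ1)]
  have hc₀δ : c₀ ≤ δ := by linarith
  calc gaussianArea 4 y t A
      ≤ ENNReal.ofReal ((1 + κ) ^ 2) * cylDensity A y ((1 + κ) * t) +
          ENNReal.ofReal c₀ * ((μH[4] (Metric.sphere (0 : EuclideanSpace ℝ (Fin 5)) 1))⁻¹ * μH[4] A) :=
        hmain
    _ ≤ ENNReal.ofReal (1 + δ) * cylDensity A y ((1 + κ) * t) +
          ENNReal.ofReal δ * ((μH[4] (Metric.sphere (0 : EuclideanSpace ℝ (Fin 5)) 1))⁻¹ * μH[4] A) := by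
        gcongr

end Summit.SmoothPoincare4.SmoothPoincare4.Cruxes.CylinderRungTwo.KillingFlux

end
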